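import Summits.RiemannHypothesis.RiemannHypothesis.Theorems.S2FormatCGramYoshida
import Summits.RiemannHypothesis.RiemannHypothesis.Theorems.WeilFormatCColumnEven
import HarnessLib

/-!
# Format C at `S = {∞, 2}` — L-C3b ORDER 1 for the semilocal kernel: the far COLUMNS of the sector kernels of
# `S2FormatC.gram b` are one structured direction plus `O(κ(i)/m²)`

Seat cc-s2-4 gen4 (`HOME/cc-s2-4/CC4-LEAN.md` §10).  weil-10's `WeilFormatCColumnEven.lean` / `WeilFormatCColumnOdd.lean`
prove, for Yoshida's FULL kernel `gramCoeff a` (prime block summed over `weilPrimeIndex a`), the order-1 column structure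
`|M⁺(i,m) − (−1)^{i+m} g_m/(4m)| ≤ κ⁺(i)/m²`, `|M⁻(i,m) − (−1)^{i+m} v⁻(i)/m| ≤ κ⁻(i)/m²` (`2i ≤ m`).  The `{∞,2}` kernel
`gram b = polarCoeff b + Λ·(K_{log 2} − 2δ) + archCoeff b` (`S2FormatC.gram_eq_yoshida`) has the SAME polar and archimedean
blocks (weil-10's piece lemmas apply verbatim with `a := b`) and ONE prime length, so this file supplies:

* the single-length increment columns, for ANY window `b`, length `t` and weight `w ≥ 0` (so any one-length kernel reuses
  them): closed forms `incrW_even_col_eq` / `incrW_odd_col_eq` and remainders `abs_incrW_even_col_sub_le`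
  (`|M⁺_{w(K_t−2δ)}(i,m) − (−1)^{i+m} w sin(ω_m t)/(πm)| ≤ (2iw/π)/m²`), `abs_incrW_odd_col_sub_le`
  (`|M⁻_{w(K_t−2δ)}(i,m) + (−1)^{i+m} w sin(ω_i t)/(πm)| ≤ (2iw/π)/m²`), `1 ≤ m`, `2i ≤ m` — weil-10's per-summand estimate;
* **`abs_gramEvenKernel_col_sub_le`** (`0 < b`, `1 ≤ m`, `2i ≤ m`):
  `|M⁺_{gram b}(i,m) − (−1)^{i+m}(1 + (4/π)Λ sin(ω_m log 2))/(4m)| ≤ κ⁺₂(i)/m²`,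
  `κ⁺₂(i) = s²b/π² + 2iΛ/π + i/2 + 8b(1+E)/(3π²)`;
* **`abs_gramOddKernel_col_sub_le`** (`0 < b`, `1 ≤ i`, `2i ≤ m`):
  `|M⁻_{gram b}(i,m) − (−1)^{i+m} v⁻₂(i)/m| ≤ κ⁻₂(i)/m²`, `v⁻₂(i) = −4s²d_i/π − Λ sin(ω_i log 2)/π − Y_i/(2π) + T_i/π`,
  `κ⁻₂(i) = s²b²/(4π³) + 2iΛ/π + i/2 + 4b(1+E)/(3π²)`

(`ω = π·/b`, `Λ = log 2/√2 = S2FormatC.lam`, `E = weilArchDensity (2b)`, `s² = (e^{b/2} − e^{−b/2})²`, `d_i = ω_i/(1+4ω_i²)`,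
`Y_i = Im ψ(¼ + iω_i/2)`, `T_i = archExpSumSin b i`).  These are weil-10's statements with `Σ_{k∈weilPrimeIndex a} Λ_k k^{−1/2}(…)`
replaced by the single term of length `log 2`; they feed the order-1 tail majorant of the `{∞,2}` rung (sequel
`S2FormatCTailTwo.lean`).  Elementary; standard axioms; no definitions; no claim about RH.
-/

set_option linter.dupNamespace false
set_option autoImplicit false

noncomputable section

open Complex Set Finset
open scoped Real BigOperators

namespace Summit.RiemannHypothesis.RiemannHypothesis.Theorems.S2FormatC

open Literature.NumberTheory.LFunctions Literature.Analysis.SpecialFunctions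
open Literature.NumberTheory.LFunctions.Yoshida1992 (freq polarCoeff incrCoeff archCoeff archExpSumSin)
open Summit.RiemannHypothesis.RiemannHypothesis.Theorems.WeilFormatC

/-! ## One increment length: closed forms of the sector columns -/

section Incr

/-- **Even column of one increment kernel** `P = w·(K_t − 2δ)`: for `0 ≤ i < m`,
`M⁺_P(i,m) = (−1)^{i+m}·w·(m sin ω_m t − i sin ω_i t)/(π(m² − i²))`. -/
theorem incrW_even_col_eq (b t w : ℝ) {i m : ℕ} (hm : 1 ≤ m) (him : i < m) :
    (if i = 0 then w * (incrCoeff b t 0 m - if (0 : ℤ) = (m : ℤ) then 2 else 0)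
      else if m = 0 then w * (incrCoeff b t i 0 - if (i : ℤ) = (0 : ℤ) then 2 else 0)
      else (w * (incrCoeff b t i m - if (i : ℤ) = (m : ℤ) then 2 else 0)
            + w * (incrCoeff b t i (-(m : ℤ)) - if (i : ℤ) = -(m : ℤ) then 2 else 0)) / 2)
      = (-1 : ℝ) ^ ((i : ℤ) + m) * (w *
          (((m : ℝ) * Real.sin (freq b m * t) - i * Real.sin (freq b i * t)) / (π * ((m : ℝ) ^ 2 - i ^ 2)))) := by
  have hm0 : (0 : ℝ) < m := by exact_mod_cast hm
  have hd1 : (i : ℝ) - m ≠ 0 := sub_ne_zero.mpr (by exact_mod_cast (ne_of_lt him))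
  have hd1' : (m : ℝ) - i ≠ 0 := sub_ne_zero.mpr (by exact_mod_cast (ne_of_gt him))
  have hd2 : (0 : ℝ) < (i : ℝ) + m := by positivity
  have hD : (m : ℝ) ^ 2 - i ^ 2 ≠ 0 := by rw [sq_sub_sq]; exact mul_ne_zero (by positivity) hd1'
  have h1 : (i : ℤ) ≠ m := by exact_mod_cast (ne_of_lt him)
  have h2 : (i : ℤ) ≠ -(m : ℤ) := by omega
  by_cases hi : i = 0
  · subst hi
    rw [if_pos rfl]
    have h0m : (0 : ℤ) ≠ m := by exact_mod_cast h1
    unfold incrCoeff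
    rw [if_neg h0m, if_neg h0m, freq_zero]
    push_cast
    simp only [zero_mul, Real.sin_zero, sub_zero, zero_sub]
    field_simp
    ring
  · rw [if_neg hi, if_neg (by omega)]
    unfold incrCoeff
    rw [if_neg h1, if_neg h2, if_neg h1, if_neg h2, freq_neg, neg_one_zpow_add_neg]
    push_cast
    simp only [neg_mul, Real.sin_neg, sub_neg_eq_add, sub_zero]
    have hd2' : (i : ℝ) + m ≠ 0 := hd2.ne'
    generalize Real.sin (freq b m * t) = sm
    generalize Real.sin (freq b i * t) = si
    field_simp
    ring

/-- **Even column remainder of one increment kernel** (`w ≥ 0`, `1 ≤ m`, `2i ≤ m`):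
`|M⁺_P(i,m) − (−1)^{i+m} w sin(ω_m t)/(πm)| ≤ (2iw/π)/m²`. -/
theorem abs_incrW_even_col_sub_le (b t : ℝ) {w : ℝ} (hw : 0 ≤ w) {i m : ℕ} (hm : 1 ≤ m) (him : 2 * i ≤ m) :
    |(if i = 0 then w * (incrCoeff b t 0 m - if (0 : ℤ) = (m : ℤ) then 2 else 0)
        else if m = 0 then w * (incrCoeff b t i 0 - if (i : ℤ) = (0 : ℤ) then 2 else 0)
        else (w * (incrCoeff b t i m - if (i : ℤ) = (m : ℤ) then 2 else 0)
              + w * (incrCoeff b t i (-(m : ℤ)) - if (i : ℤ) = -(m : ℤ) then 2 else 0)) / 2)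
        - (-1 : ℝ) ^ ((i : ℤ) + m) * (w * Real.sin (freq b m * t)) / (π * m)|
      ≤ (2 * i * w / π) / (m : ℝ) ^ 2 := by
  have him' : i < m := by omega
  have hm0 : (0 : ℝ) < m := by exact_mod_cast hm
  have hi0 : (0 : ℝ) ≤ i := by positivity
  obtain ⟨hD34, hihalf, hDpos⟩ := col_index_bounds' hm him
  have hD : (m : ℝ) ^ 2 - i ^ 2 ≠ 0 := hDpos.ne'
  rw [incrW_even_col_eq b t w hm him']
  have hsm := Real.abs_sin_le_one (freq b m * t)
  have hsi := Real.abs_sin_le_one (freq b i * t)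
  generalize Real.sin (freq b m * t) = sm at hsm ⊢
  generalize Real.sin (freq b i * t) = si at hsi ⊢
  have e : (-1 : ℝ) ^ ((i : ℤ) + m) * (w * (((m : ℝ) * sm - i * si) / (π * ((m : ℝ) ^ 2 - i ^ 2))))
        - (-1 : ℝ) ^ ((i : ℤ) + m) * (w * sm) / (π * m)
      = (-1 : ℝ) ^ ((i : ℤ) + m) * (w * (((i : ℝ) ^ 2 * sm - i * m * si) / (π * m * ((m : ℝ) ^ 2 - i ^ 2)))) := by
    field_simp
    ring
  rw [e, abs_mul, abs_neg_one_zpow_natCast_add', one_mul, abs_mul, abs_of_nonneg hw]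
  have hfrac : |((i : ℝ) ^ 2 * sm - i * m * si) / (π * m * ((m : ℝ) ^ 2 - i ^ 2))| ≤ 2 * i / (π * m ^ 2) := by
    rw [abs_div, abs_of_pos (by positivity : (0 : ℝ) < π * m * ((m : ℝ) ^ 2 - i ^ 2)),
      div_le_div_iff₀ (by positivity) (by positivity)]
    have hnum : |(i : ℝ) ^ 2 * sm - i * m * si| ≤ (i : ℝ) ^ 2 + i * m := by
      have h1 : |(i : ℝ) ^ 2 * sm| ≤ (i : ℝ) ^ 2 := by
        rw [abs_mul, abs_of_nonneg (by positivity : (0 : ℝ) ≤ (i : ℝ) ^ 2)]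
        exact mul_le_of_le_one_right (by positivity) hsm
      have h2 : |(i : ℝ) * m * si| ≤ (i : ℝ) * m := by
        rw [abs_mul, abs_of_nonneg (by positivity : (0 : ℝ) ≤ (i : ℝ) * m)]
        exact mul_le_of_le_one_right (by positivity) hsi
      exact (abs_sub _ _).trans (add_le_add h1 h2)
    have hlhs := mul_le_mul_of_nonneg_right hnum (by positivity : (0 : ℝ) ≤ π * m ^ 2)
    refine hlhs.trans ?_
    have h2i : (0 : ℝ) ≤ m - 2 * i := by
      have : 2 * (i : ℝ) ≤ m := by exact_mod_cast him
      linarith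
    have key : 0 ≤ π * i * m * ((m : ℝ) + i) * (m - 2 * i) := by positivity
    nlinarith [key]
  calc w * |((i : ℝ) ^ 2 * sm - i * m * si) / (π * m * ((m : ℝ) ^ 2 - i ^ 2))|
      ≤ w * (2 * i / (π * m ^ 2)) := mul_le_mul_of_nonneg_left hfrac hw
    _ = (2 * i * w / π) / (m : ℝ) ^ 2 := by
        field_simp

/-- **Odd column of one increment kernel** `P = w·(K_t − 2δ)`: for `1 ≤ i < m`,
`M⁻_P(i,m) = (P(i,m) − P(i,−m))/2 = (−1)^{i+m}·w·(i sin ω_m t − m sin ω_i t)/(π(m² − i²))`. -/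
theorem incrW_odd_col_eq (b t w : ℝ) {i m : ℕ} (hi : 1 ≤ i) (him : i < m) :
    (w * (incrCoeff b t i m - if (i : ℤ) = (m : ℤ) then 2 else 0)
      - w * (incrCoeff b t i (-(m : ℤ)) - if (i : ℤ) = -(m : ℤ) then 2 else 0)) / 2
      = (-1 : ℝ) ^ ((i : ℤ) + m) * (w *
          (((i : ℝ) * Real.sin (freq b m * t) - m * Real.sin (freq b i * t)) / (π * ((m : ℝ) ^ 2 - i ^ 2)))) := by
  have hd1 : (i : ℝ) - m ≠ 0 := sub_ne_zero.mpr (by exact_mod_cast (ne_of_lt him))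
  have hd1' : (m : ℝ) - i ≠ 0 := sub_ne_zero.mpr (by exact_mod_cast (ne_of_gt him))
  have hd2 : (0 : ℝ) < (i : ℝ) + m := by
    have : (1 : ℝ) ≤ i := by exact_mod_cast hi
    have : (0 : ℝ) ≤ m := by positivity
    linarith
  have hD : (m : ℝ) ^ 2 - i ^ 2 ≠ 0 := by rw [sq_sub_sq]; exact mul_ne_zero (by positivity) hd1'
  have h1 : (i : ℤ) ≠ m := by exact_mod_cast (ne_of_lt him)
  have h2 : (i : ℤ) ≠ -(m : ℤ) := by omega
  unfold incrCoeff
  rw [if_neg h1, if_neg h2, if_neg h1, if_neg h2, freq_neg, neg_one_zpow_add_neg]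
  push_cast
  simp only [neg_mul, Real.sin_neg, sub_neg_eq_add, sub_zero]
  have hd2' : (i : ℝ) + m ≠ 0 := hd2.ne'
  generalize Real.sin (freq b m * t) = sm
  generalize Real.sin (freq b i * t) = si
  field_simp
  ring

/-- **Odd column remainder of one increment kernel** (`w ≥ 0`, `1 ≤ i`, `2i ≤ m`):
`|M⁻_P(i,m) + (−1)^{i+m} w sin(ω_i t)/(πm)| ≤ (2iw/π)/m²`. -/
theorem abs_incrW_odd_col_sub_le (b t : ℝ) {w : ℝ} (hw : 0 ≤ w) {i m : ℕ} (hi : 1 ≤ i) (him : 2 * i ≤ m) :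
    |(w * (incrCoeff b t i m - if (i : ℤ) = (m : ℤ) then 2 else 0)
        - w * (incrCoeff b t i (-(m : ℤ)) - if (i : ℤ) = -(m : ℤ) then 2 else 0)) / 2
        + (-1 : ℝ) ^ ((i : ℤ) + m) * (w * Real.sin (freq b i * t)) / (π * m)|
      ≤ (2 * i * w / π) / (m : ℝ) ^ 2 := by
  have hm : 1 ≤ m := by omega
  have him' : i < m := by omega
  have hm0 : (0 : ℝ) < m := by exact_mod_cast hm
  have hi0 : (0 : ℝ) ≤ i := by positivity
  obtain ⟨hD34, hihalf, hDpos⟩ := col_index_bounds' hm him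
  have hD : (m : ℝ) ^ 2 - i ^ 2 ≠ 0 := hDpos.ne'
  rw [incrW_odd_col_eq b t w hi him']
  have hsm := Real.abs_sin_le_one (freq b m * t)
  have hsi := Real.abs_sin_le_one (freq b i * t)
  generalize Real.sin (freq b m * t) = sm at hsm ⊢
  generalize Real.sin (freq b i * t) = si at hsi ⊢
  have e : (-1 : ℝ) ^ ((i : ℤ) + m) * (w * (((i : ℝ) * sm - m * si) / (π * ((m : ℝ) ^ 2 - i ^ 2))))
        + (-1 : ℝ) ^ ((i : ℤ) + m) * (w * si) / (π * m)
      = (-1 : ℝ) ^ ((i : ℤ) + m) * (w * (((i : ℝ) * m * sm - i ^ 2 * si) / (π * m * ((m : ℝ) ^ 2 - i ^ 2)))) := by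
    field_simp
    ring
  rw [e, abs_mul, abs_neg_one_zpow_natCast_add', one_mul, abs_mul, abs_of_nonneg hw]
  have hfrac : |((i : ℝ) * m * sm - i ^ 2 * si) / (π * m * ((m : ℝ) ^ 2 - i ^ 2))| ≤ 2 * i / (π * m ^ 2) := by
    rw [abs_div, abs_of_pos (by positivity : (0 : ℝ) < π * m * ((m : ℝ) ^ 2 - i ^ 2)),
      div_le_div_iff₀ (by positivity) (by positivity)]
    have hnum : |(i : ℝ) * m * sm - i ^ 2 * si| ≤ (i : ℝ) * m + i ^ 2 := by
      have h1 : |(i : ℝ) * m * sm| ≤ (i : ℝ) * m := by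
        rw [abs_mul, abs_of_nonneg (by positivity : (0 : ℝ) ≤ (i : ℝ) * m)]
        exact mul_le_of_le_one_right (by positivity) hsm
      have h2 : |(i : ℝ) ^ 2 * si| ≤ (i : ℝ) ^ 2 := by
        rw [abs_mul, abs_of_nonneg (by positivity : (0 : ℝ) ≤ (i : ℝ) ^ 2)]
        exact mul_le_of_le_one_right (by positivity) hsi
      exact (abs_sub _ _).trans (add_le_add h1 h2)
    have hlhs := mul_le_mul_of_nonneg_right hnum (by positivity : (0 : ℝ) ≤ π * m ^ 2)
    refine hlhs.trans ?_
    have h2i : (0 : ℝ) ≤ m - 2 * i := by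
      have : 2 * (i : ℝ) ≤ m := by exact_mod_cast him
      linarith
    have key : 0 ≤ π * i * m * ((m : ℝ) + i) * (m - 2 * i) := by positivity
    nlinarith [key]
  calc w * |((i : ℝ) * m * sm - i ^ 2 * si) / (π * m * ((m : ℝ) ^ 2 - i ^ 2))|
      ≤ w * (2 * i / (π * m ^ 2)) := mul_le_mul_of_nonneg_left hfrac hw
    _ = (2 * i * w / π) / (m : ℝ) ^ 2 := by
        field_simp

end Incr

/-! ## The `{∞,2}` kernel columns -/

section Kernel

variable {b : ℝ}

/-- `0 ≤ Λ = log 2/√2`. -/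
theorem lam_nonneg : 0 ≤ lam := by
  unfold lam
  exact div_nonneg (Real.log_nonneg (by norm_num)) (Real.sqrt_nonneg _)

/-- **Order-1 column structure of the `{∞,2}` kernel, even sector** (`0 < b`, `1 ≤ m`, `2i ≤ m`):
`|M⁺_{gram b}(i,m) − (−1)^{i+m}(1 + (4/π)Λ sin(ω_m log 2))/(4m)| ≤ κ⁺₂(i)/m²`,
`κ⁺₂(i) = s²b/π² + 2iΛ/π + i/2 + 8b(1+E)/(3π²)` — weil-10's `abs_evenKernel_col_sub_le` with the one prime length. -/
theorem abs_gramEvenKernel_col_sub_le (hb : 0 < b) {i m : ℕ} (hm : 1 ≤ m) (him : 2 * i ≤ m) :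
    |(if i = 0 then gram b 0 m else if m = 0 then gram b i 0 else (gram b i m + gram b i (-(m : ℤ))) / 2)
        - (-1 : ℝ) ^ ((i : ℤ) + m) * (1 + 4 / π * (lam * Real.sin (freq b m * Real.log 2))) / (4 * m)|
      ≤ ((Real.exp (b / 2) - Real.exp (-(b / 2))) ^ 2 * b / π ^ 2
          + 2 * i * lam / π
          + ((i : ℝ) / 2 + 8 * b * (1 + weilArchDensity (2 * b)) / (3 * π ^ 2))) / (m : ℝ) ^ 2 := by
  have him' : i < m := by omega
  have hm0 : (0 : ℝ) < m := by exact_mod_cast hm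
  -- split the kernel into the three pieces
  have hsplit : (if i = 0 then gram b 0 m else if m = 0 then gram b i 0 else (gram b i m + gram b i (-(m : ℤ))) / 2)
      = (if i = 0 then polarCoeff b 0 m else if m = 0 then polarCoeff b i 0
          else (polarCoeff b i m + polarCoeff b i (-(m : ℤ))) / 2)
        + (if i = 0 then lam * (incrCoeff b (Real.log 2) 0 m - if (0 : ℤ) = (m : ℤ) then 2 else 0)
          else if m = 0 then lam * (incrCoeff b (Real.log 2) i 0 - if (i : ℤ) = (0 : ℤ) then 2 else 0)
          else (lam * (incrCoeff b (Real.log 2) i m - if (i : ℤ) = (m : ℤ) then 2 else 0)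
                + lam * (incrCoeff b (Real.log 2) i (-(m : ℤ)) - if (i : ℤ) = -(m : ℤ) then 2 else 0)) / 2)
        + (if i = 0 then archCoeff b 0 m else if m = 0 then archCoeff b i 0
          else (archCoeff b i m + archCoeff b i (-(m : ℤ))) / 2) := by
    by_cases hi : i = 0
    · subst hi
      simp only [if_true]
      rw [gram_eq_yoshida hb]
    · have hm' : m ≠ 0 := by omega
      simp only [if_neg hi, if_neg hm']
      rw [gram_eq_yoshida hb, gram_eq_yoshida hb]
      ring
  have hP := abs_evenPolar_col_le hb hm (ne_of_lt him')
  have hQ := abs_incrW_even_col_sub_le b (Real.log 2) lam_nonneg hm him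
  have hR := abs_evenArch_col_sub_le hb hm him
  have e : (if i = 0 then gram b 0 m else if m = 0 then gram b i 0 else (gram b i m + gram b i (-(m : ℤ))) / 2)
        - (-1 : ℝ) ^ ((i : ℤ) + m) * (1 + 4 / π * (lam * Real.sin (freq b m * Real.log 2))) / (4 * m)
      = (if i = 0 then polarCoeff b 0 m else if m = 0 then polarCoeff b i 0
          else (polarCoeff b i m + polarCoeff b i (-(m : ℤ))) / 2)
        + ((if i = 0 then lam * (incrCoeff b (Real.log 2) 0 m - if (0 : ℤ) = (m : ℤ) then 2 else 0)
            else if m = 0 then lam * (incrCoeff b (Real.log 2) i 0 - if (i : ℤ) = (0 : ℤ) then 2 else 0)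
            else (lam * (incrCoeff b (Real.log 2) i m - if (i : ℤ) = (m : ℤ) then 2 else 0)
                  + lam * (incrCoeff b (Real.log 2) i (-(m : ℤ)) - if (i : ℤ) = -(m : ℤ) then 2 else 0)) / 2)
          - (-1 : ℝ) ^ ((i : ℤ) + m) * (lam * Real.sin (freq b m * Real.log 2)) / (π * m))
        + ((if i = 0 then archCoeff b 0 m else if m = 0 then archCoeff b i 0
            else (archCoeff b i m + archCoeff b i (-(m : ℤ))) / 2)
          - (-1 : ℝ) ^ ((i : ℤ) + m) / (4 * m)) := by
    rw [hsplit]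
    field_simp
    ring
  rw [e]
  refine ((abs_add_le _ _).trans (add_le_add ((abs_add_le _ _).trans (add_le_add hP hQ)) hR)).trans (le_of_eq ?_)
  ring

/-- **Order-1 column structure of the `{∞,2}` kernel, odd sector** (`0 < b`, `1 ≤ i`, `2i ≤ m`; modes `i`, `m` =
kernel indices `i−1`, `m−1`): `|M⁻_{gram b}(i,m) − (−1)^{i+m} v⁻₂(i)/m| ≤ κ⁻₂(i)/m²` with
`v⁻₂(i) = −4s²d_i/π − Λ sin(ω_i log 2)/π − Y_i/(2π) + T_i/π`, `κ⁻₂(i) = s²b²/(4π³) + 2iΛ/π + i/2 + 4b(1+E)/(3π²)`. -/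
theorem abs_gramOddKernel_col_sub_le (hb : 0 < b) {i m : ℕ} (hi : 1 ≤ i) (him : 2 * i ≤ m) :
    |(gram b i m - gram b i (-(m : ℤ))) / 2
        - (-1 : ℝ) ^ ((i : ℤ) + m) *
          (-(4 * (Real.exp (b / 2) - Real.exp (-(b / 2))) ^ 2 * (freq b i / (1 + 4 * freq b i ^ 2)) / π)
            - lam * Real.sin (freq b i * Real.log 2) / π
            - (Complex.digamma (1 / 4 + ((freq b i : ℝ) : ℂ) / 2 * I)).im / (2 * π) + archExpSumSin b i / π) / m|
      ≤ ((Real.exp (b / 2) - Real.exp (-(b / 2))) ^ 2 * b ^ 2 / (4 * π ^ 3)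
          + 2 * i * lam / π
          + ((i : ℝ) / 2 + 4 * b * (1 + weilArchDensity (2 * b)) / (3 * π ^ 2))) / (m : ℝ) ^ 2 := by
  have hm : 1 ≤ m := by omega
  have hm0 : (0 : ℝ) < m := by exact_mod_cast hm
  have hP := abs_oddPolar_col_sub_le hb hi hm
  have hQ := abs_incrW_odd_col_sub_le b (Real.log 2) lam_nonneg hi him
  have hR := abs_oddArch_col_sub_le hb hi him
  have e : (gram b i m - gram b i (-(m : ℤ))) / 2
        - (-1 : ℝ) ^ ((i : ℤ) + m) *
          (-(4 * (Real.exp (b / 2) - Real.exp (-(b / 2))) ^ 2 * (freq b i / (1 + 4 * freq b i ^ 2)) / π)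
            - lam * Real.sin (freq b i * Real.log 2) / π
            - (Complex.digamma (1 / 4 + ((freq b i : ℝ) : ℂ) / 2 * I)).im / (2 * π) + archExpSumSin b i / π) / m
      = ((polarCoeff b i m - polarCoeff b i (-(m : ℤ))) / 2
          + (-1 : ℝ) ^ ((i : ℤ) + m) * (4 * (Real.exp (b / 2) - Real.exp (-(b / 2))) ^ 2
              * (freq b i / (1 + 4 * freq b i ^ 2)) / π) / m)
        + ((lam * (incrCoeff b (Real.log 2) i m - if (i : ℤ) = (m : ℤ) then 2 else 0)
            - lam * (incrCoeff b (Real.log 2) i (-(m : ℤ)) - if (i : ℤ) = -(m : ℤ) then 2 else 0)) / 2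
          + (-1 : ℝ) ^ ((i : ℤ) + m) * (lam * Real.sin (freq b i * Real.log 2)) / (π * m))
        + ((archCoeff b i m - archCoeff b i (-(m : ℤ))) / 2
          - (-1 : ℝ) ^ ((i : ℤ) + m) *
            (-(Complex.digamma (1 / 4 + ((freq b i : ℝ) : ℂ) / 2 * I)).im / (2 * π) + archExpSumSin b i / π) / m) := by
    rw [gram_eq_yoshida hb, gram_eq_yoshida hb]
    field_simp
    ring
  rw [e]
  refine ((abs_add_le _ _).trans (add_le_add ((abs_add_le _ _).trans (add_le_add hP hQ)) hR)).trans (le_of_eq ?_)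
  ring

end Kernel

end Summit.RiemannHypothesis.RiemannHypothesis.Theorems.S2FormatC

end
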